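import Summits.QuantumFields.BalabanUV.Beta.FP.MixLoopPowerCounting

/-!
# `BalabanUV.Beta.FP.MixLoopPowerCountingSeam` — road «FP» (binder row D1), remainder `ρ_n` of the H′ bookkeeping, row **RHOA-6c** «GENERIC POWER COUNTING OF THE MIX
# LOOPS», FILE E: the loop **(MIX-2)** `−tr(Q̇𝓘·Q̇𝓘)` at a GENERAL AVERAGING-LOCALITY RADIUS `R₀·n` — the consumer-side repair of the located seam finding SEAM-1 on FILE A
# ([folklore] lattice bookkeeping on `ℤ⁴`; abstract kernels, every letter a displayed hypothesis; NO road object)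

HONEST DEPENDENCY (page 1, mandatory): continuum YM on T⁴ ⇐ BetaPertH ∧ nine spine estimates (0/9 proved); BetaPertH ⇐ (D1) ∧ (D4) ∧
CAP+tail; G-an2-4 gates asym, D1 and NE2/3/4.  HONEST FRAMING (cell contract, verbatim): «discharging `BetaPertH` makes Bałaban's UV
stability UNCONDITIONAL — a real constructive-QFT result; it is NOT the continuum limit and NOT the Clay problem.»  THIS MODULE is elementary
[folklore] real analysis on `ℤ⁴` over FILE A's shell engine (`MixLoopPowerCounting.sum_sq_mul_exp_le`); it asserts nothing about Bałaban's objects, cites nothing, mints no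
`Prop` fact, has no `def`, 0 sorry.  The LETTERS of `q̇` (row RHOA-6b) and `𝓘` (row IR-I) are HYPOTHESES displayed in the signatures; NOT `Mix_n = O(1)` for Bałaban's objects
(row RHOA-6e assembles), NOT `hbook`, NOT D1, NOT BetaPertH, NOT continuum, NOT Clay.

WHY (XREAD C-ne7bleaf08g20-4 of FILE A p243368, SEAM-1, journal 2026-08-21T01:14Z; seam probe `HOME/t4/b2b-balaban-t4-ne7b-formalise-leaf-08/g20/xread/x4/ProbeSeam6b6c.lean`):
FILE A's §3 states the (MIX-2) second moment under the averaging-locality letter `‖b − n•u‖∞ ≤ n` for the coarse sites `u ∈ U b` that see the insertion `b`; the designated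
supplier RHOA-6b (`FP/AveragingJetLetters*`, gan24-formalise-leaf-04-g41) realises Bałaban's straight contours `[x, x(c)]`, which run `n − 1` bonds into the neighbouring block,
so a block at sup-distance up to `2n − 2` inserts at `b` (kernel witness σ5: `dotCount 4 0 0 ![5,0,0,0] ![6,0,0,0] ≠ 0`, distance `5 > 4`).  THIS FILE re-proves §3 with the
radius a PARAMETER `R₀·n` (`R₀ : ℕ`): the leg comparison costs `e^{(R₀+1)δ}` instead of `e^{2δ}`, everything else — in particular the EXACT powers `n⁻⁶·n⁶` — is unchanged;
RHOA-6e instantiates at `R₀ = 2`.  FILE A's radius-`n` theorems remain correct for their displayed letters (the case `R₀ = 1`).  (MIX-1), (MIX-3), (MIX-4) do not use the locality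
letter (FILES B∕C∕D), so nothing else is touched.

CONTENT (twins of FILE A §3 with `hU : ‖b − n•u‖∞ ≤ R₀·n`): `exp_leg_le_radius`, `abs_smearedLeg_le_radius`, **`abs_mix2_le_radius`** (`(A∕n³)²(C_Ie^{(R₀+1)δ})²e^{−(2δ∕n)‖b′−b‖}`),
**`mix2_secondMoment_le_radius`** (`≤ A²(C_Ie^{(R₀+1)δ})²(1 + 9600e^{δ}δ⁻⁶)` for every finite `S`), `tsum_mix2_secondMoment_le_radius` (summable over all `b′ ∈ ℤ⁴` + the same bound).
Provenance: cross-cell idle-seat kernel duty NE7b → β∕D1, unit `b2b-balaban-t4-ne7b-formalise-leaf-01` gen 23, 2026-08-21; journal INTENT ∕ CLAIM «RHOA-6c» l.23908; seam located by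
`b2b-balaban-t4-ne7b-formalise-leaf-08` gen 20 (C-ne7bleaf08g20-4 SEAM-1); «not in print; our bookkeeping»; no existing file touched.
-/

noncomputable section

namespace Summit.QuantumFields.BalabanUV.Beta.FP.MixLoopPowerCountingSeam

open Finset Real
open scoped BigOperators
open Literature.MathematicalPhysics.QuantumFieldTheory.Balaban1983to89.Beta.DyadicShell (Pt supNorm)
open Literature.MathematicalPhysics.QuantumFieldTheory.Balaban1983to89.Beta.GradedBubbles (supNorm_neg)
open Literature.MathematicalPhysics.QuantumFieldTheory.Balaban1983to89.Beta.BlockLegs (supNorm_sub_le_real supNorm_add_le_real)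
open Summit.QuantumFields.BalabanUV.Beta.FP.MixLoopPowerCounting (sum_sq_mul_exp_le supNorm_cast_nonneg)

/-! ## (MIX-2) at averaging-locality radius `R₀·n` -/

section Mix2Radius

variable {U : Pt → Finset Pt} {W : Finset Pt} {qd : Pt → Pt → Pt → ℝ} {I : Pt → Pt → ℝ} {A C_I δ : ℝ} {n R₀ : ℕ}

/-- [folklore] **THE LEG COMPARISON AT LOCALITY RADIUS `R₀·n`**: `e^{−(δ∕n)‖b + w − n•u′‖∞} ≤ e^{(R₀+1)δ}·e^{−(δ∕n)‖b′ − b‖∞}` for `u′` seeing `b′`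
(`‖b′ − b‖ ≤ ‖b′ − n•u′‖ + ‖b + w − n•u′‖ + ‖w‖ ≤ R₀n + ‖b + w − n•u′‖ + n`). -/
theorem exp_leg_le_radius (hδ : 0 < δ) (hn : 1 ≤ n) (hW : ∀ w ∈ W, supNorm w ≤ n) {b' u' w : Pt}
    (hu' : supNorm (b' - (n : ℤ) • u') ≤ R₀ * n) (hw : w ∈ W) (b : Pt) :
    Real.exp (-(δ / n) * (supNorm (b + w - (n : ℤ) • u') : ℝ)) ≤ Real.exp (((R₀ : ℝ) + 1) * δ) * Real.exp (-(δ / n) * (supNorm (b' - b) : ℝ)) := by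
  have hn' : (0 : ℝ) < n := by exact_mod_cast hn
  have htri : (supNorm (b' - b) : ℝ) ≤ (R₀ : ℝ) * n + (supNorm (b + w - (n : ℤ) • u') : ℝ) + n := by
    have e : b' - b = (b' - (n : ℤ) • u') - (b + w - (n : ℤ) • u') + w := by abel
    have h1 := supNorm_add_le_real ((b' - (n : ℤ) • u') - (b + w - (n : ℤ) • u')) w
    have h2 := supNorm_sub_le_real (b' - (n : ℤ) • u') (b + w - (n : ℤ) • u')
    have h3 : (supNorm (b' - (n : ℤ) • u') : ℝ) ≤ (R₀ : ℝ) * n := by exact_mod_cast hu'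
    have h4 : (supNorm w : ℝ) ≤ n := by exact_mod_cast hW w hw
    rw [e]; linarith
  rw [← Real.exp_add]
  apply Real.exp_le_exp.mpr
  have hdn : 0 < δ / n := by positivity
  have hR : (0 : ℝ) ≤ R₀ := Nat.cast_nonneg R₀
  have : -(δ / n) * (supNorm (b' - b) : ℝ) ≥ -(δ / n) * ((R₀ : ℝ) * n + (supNorm (b + w - (n : ℤ) • u') : ℝ) + n) := by nlinarith
  have e2 : (δ / n) * n = δ := div_mul_cancel₀ δ hn'.ne'
  have e3 : (δ / n) * ((R₀ : ℝ) * n) = (R₀ : ℝ) * δ := by rw [mul_left_comm, e2]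
  nlinarith

/-- [folklore] One smeared interpolation leg at radius `R₀·n`: `|Σ_{w∈W} q̇(u;b,b+w)·𝓘(b+w,u′)| ≤ (Σ_w |q̇(u;b,b+w)|)·C_I·e^{(R₀+1)δ}·e^{−(δ∕n)‖b′−b‖∞}`. -/
theorem abs_smearedLeg_le_radius (hδ : 0 < δ) (hn : 1 ≤ n) (hW : ∀ w ∈ W, supNorm w ≤ n)
    (hI : ∀ c u, |I c u| ≤ C_I * Real.exp (-(δ / n) * (supNorm (c - (n : ℤ) • u) : ℝ))) {b' u' : Pt}
    (hu' : supNorm (b' - (n : ℤ) • u') ≤ R₀ * n) (u b : Pt) :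
    |∑ w ∈ W, qd u b (b + w) * I (b + w) u'|
      ≤ (∑ w ∈ W, |qd u b (b + w)|) * (C_I * Real.exp (((R₀ : ℝ) + 1) * δ) * Real.exp (-(δ / n) * (supNorm (b' - b) : ℝ))) := by
  have hC : 0 ≤ C_I := by
    have h := hI b u
    have : 0 < Real.exp (-(δ / n) * (supNorm (b - (n : ℤ) • u) : ℝ)) := Real.exp_pos _
    nlinarith [abs_nonneg (I b u)]
  rw [Finset.sum_mul]
  refine (Finset.abs_sum_le_sum_abs _ _).trans (Finset.sum_le_sum fun w hw => ?_)
  rw [abs_mul]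
  refine mul_le_mul_of_nonneg_left ((hI _ _).trans ?_) (abs_nonneg _)
  rw [mul_assoc]
  exact mul_le_mul_of_nonneg_left (exp_leg_le_radius hδ hn hW hu' hw b) hC

/-- **(MIX-2) POINTWISE SHAPE AT RADIUS `R₀·n`**: `|k₂(b,b′)| ≤ (A∕n³)²·(C_I·e^{(R₀+1)δ})²·e^{−(2δ∕n)‖b′−b‖∞}`. [folklore] -/
theorem abs_mix2_le_radius (hδ : 0 < δ) (hn : 1 ≤ n) (hU : ∀ b, ∀ u ∈ U b, supNorm (b - (n : ℤ) • u) ≤ R₀ * n)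
    (hW : ∀ w ∈ W, supNorm w ≤ n) (hq : ∀ b, ∑ u ∈ U b, ∑ w ∈ W, |qd u b (b + w)| ≤ A / (n : ℝ) ^ 3)
    (hI : ∀ c u, |I c u| ≤ C_I * Real.exp (-(δ / n) * (supNorm (c - (n : ℤ) • u) : ℝ))) (b b' : Pt) :
    |∑ u ∈ U b, ∑ u' ∈ U b', (∑ w ∈ W, qd u b (b + w) * I (b + w) u') * (∑ w' ∈ W, qd u' b' (b' + w') * I (b' + w') u)|
      ≤ (A / (n : ℝ) ^ 3) ^ 2 * (C_I * Real.exp (((R₀ : ℝ) + 1) * δ)) ^ 2 * Real.exp (-(2 * δ / n) * (supNorm (b' - b) : ℝ)) := by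
  set E : ℝ := C_I * Real.exp (((R₀ : ℝ) + 1) * δ) * Real.exp (-(δ / n) * (supNorm (b' - b) : ℝ)) with hE
  have hC : 0 ≤ C_I := by
    have h := hI b b
    have : 0 < Real.exp (-(δ / n) * (supNorm (b - (n : ℤ) • b) : ℝ)) := Real.exp_pos _
    nlinarith [abs_nonneg (I b b)]
  have hE0 : 0 ≤ E := by positivity
  set m : Pt → Pt → ℝ := fun b u => ∑ w ∈ W, |qd u b (b + w)| with hm
  have hm0 : ∀ b u, 0 ≤ m b u := fun b u => Finset.sum_nonneg fun w _ => abs_nonneg _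
  -- the two smeared legs
  have hX : ∀ u, ∀ u' ∈ U b', |∑ w ∈ W, qd u b (b + w) * I (b + w) u'| ≤ m b u * E :=
    fun u u' hu' => abs_smearedLeg_le_radius hδ hn hW hI (hU b' u' hu') u b
  have hY : ∀ u ∈ U b, ∀ u', |∑ w' ∈ W, qd u' b' (b' + w') * I (b' + w') u| ≤ m b' u' * E := by
    intro u hu u'
    have h := abs_smearedLeg_le_radius (qd := qd) hδ hn hW hI (hU b u hu) u' b'
    have e : (supNorm (b - b') : ℝ) = supNorm (b' - b) := by rw [← supNorm_neg, neg_sub]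
    rwa [e] at h
  calc |∑ u ∈ U b, ∑ u' ∈ U b', (∑ w ∈ W, qd u b (b + w) * I (b + w) u') * (∑ w' ∈ W, qd u' b' (b' + w') * I (b' + w') u)|
      ≤ ∑ u ∈ U b, ∑ u' ∈ U b', (m b u * E) * (m b' u' * E) := by
        refine (Finset.abs_sum_le_sum_abs _ _).trans (Finset.sum_le_sum fun u hu =>
          (Finset.abs_sum_le_sum_abs _ _).trans (Finset.sum_le_sum fun u' hu' => ?_))
        rw [abs_mul]
        exact mul_le_mul (hX u u' hu') (hY u hu u') (abs_nonneg _) (mul_nonneg (hm0 b u) hE0)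
    _ = E ^ 2 * ((∑ u ∈ U b, m b u) * (∑ u' ∈ U b', m b' u')) := by
        rw [Finset.sum_mul_sum]
        rw [Finset.mul_sum]
        refine Finset.sum_congr rfl fun u _ => ?_
        rw [Finset.mul_sum]
        exact Finset.sum_congr rfl fun u' _ => by ring
    _ ≤ E ^ 2 * ((A / (n : ℝ) ^ 3) * (A / (n : ℝ) ^ 3)) := by
        have h1 : ∑ u ∈ U b, m b u ≤ A / (n : ℝ) ^ 3 := hq b
        have h2 : ∑ u' ∈ U b', m b' u' ≤ A / (n : ℝ) ^ 3 := hq b'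
        have hA : 0 ≤ A / (n : ℝ) ^ 3 := (Finset.sum_nonneg fun u _ => hm0 b u).trans h1
        exact mul_le_mul_of_nonneg_left (mul_le_mul h1 h2 (Finset.sum_nonneg fun u _ => hm0 b' u) hA) (sq_nonneg E)
    _ = (A / (n : ℝ) ^ 3) ^ 2 * (C_I * Real.exp (((R₀ : ℝ) + 1) * δ)) ^ 2 * Real.exp (-(2 * δ / n) * (supNorm (b' - b) : ℝ)) := by
        have e2 : Real.exp (-(2 * δ / n) * (supNorm (b' - b) : ℝ)) = Real.exp (-(δ / n) * (supNorm (b' - b) : ℝ)) ^ 2 := by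
          rw [sq, ← Real.exp_add]; congr 1; ring
        rw [e2, hE]; ring

/-- **(MIX-2) SECOND MOMENT AT RADIUS `R₀·n`, n-FREE**: for every finite set `S` of second insertions,
`Σ_{b′∈S} ‖b′−b‖∞²·|k₂(b,b′)| ≤ A²·(C_I·e^{(R₀+1)δ})²·(1 + 9600·e^{δ}·δ⁻⁶)` — the repair of SEAM-1: the supplier RHOA-6b's locality radius is `2n − 2`
(`AveragingJetLettersBounds.supNorm_sub_le_of_mem_ctrPts`), so RHOA-6e instantiates at `R₀ = 2` (`(C_Ie^{3δ})²`); exact powers unchanged. [folklore] -/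
theorem mix2_secondMoment_le_radius (hδ : 0 < δ) (hn : 1 ≤ n) (hU : ∀ b, ∀ u ∈ U b, supNorm (b - (n : ℤ) • u) ≤ R₀ * n)
    (hW : ∀ w ∈ W, supNorm w ≤ n) (hq : ∀ b, ∑ u ∈ U b, ∑ w ∈ W, |qd u b (b + w)| ≤ A / (n : ℝ) ^ 3)
    (hI : ∀ c u, |I c u| ≤ C_I * Real.exp (-(δ / n) * (supNorm (c - (n : ℤ) • u) : ℝ))) (b : Pt) (S : Finset Pt) :
    ∑ b' ∈ S, (supNorm (b' - b) : ℝ) ^ 2 *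
        |∑ u ∈ U b, ∑ u' ∈ U b', (∑ w ∈ W, qd u b (b + w) * I (b + w) u') * (∑ w' ∈ W, qd u' b' (b' + w') * I (b' + w') u)|
      ≤ A ^ 2 * (C_I * Real.exp (((R₀ : ℝ) + 1) * δ)) ^ 2 * (1 + 9600 * Real.exp δ * δ⁻¹ ^ 6) := by
  have hn' : (0 : ℝ) < n := by exact_mod_cast hn
  have h2δ : 0 < 2 * δ := by linarith
  set g : Pt → ℝ := fun z => (supNorm z : ℝ) ^ 2 * Real.exp (-(2 * δ / n) * (supNorm z : ℝ)) with hg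
  -- termwise pointwise shape
  have hterm : ∀ b' ∈ S, (supNorm (b' - b) : ℝ) ^ 2 *
      |∑ u ∈ U b, ∑ u' ∈ U b', (∑ w ∈ W, qd u b (b + w) * I (b + w) u') * (∑ w' ∈ W, qd u' b' (b' + w') * I (b' + w') u)|
        ≤ ((A / (n : ℝ) ^ 3) ^ 2 * (C_I * Real.exp (((R₀ : ℝ) + 1) * δ)) ^ 2) * g (b' - b) := by
    intro b' _
    have h := abs_mix2_le_radius hδ hn hU hW hq hI b b'
    have h0 : 0 ≤ (supNorm (b' - b) : ℝ) ^ 2 := by positivity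
    calc _ ≤ (supNorm (b' - b) : ℝ) ^ 2 * ((A / (n : ℝ) ^ 3) ^ 2 * (C_I * Real.exp (((R₀ : ℝ) + 1) * δ)) ^ 2 *
          Real.exp (-(2 * δ / n) * (supNorm (b' - b) : ℝ))) := mul_le_mul_of_nonneg_left h h0
      _ = _ := by rw [hg]; ring
  -- reindex by the separation and apply the engine at rate `2δ`
  have hinj : Set.InjOn (fun b' : Pt => b' - b) S := fun x _ y _ h => sub_left_injective h
  have hsum : ∑ b' ∈ S, g (b' - b) = ∑ z ∈ S.image (fun b' => b' - b), g z := (Finset.sum_image hinj).symm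
  have heng : ∑ z ∈ S.image (fun b' => b' - b), g z ≤ (1 + 9600 * Real.exp (2 * δ / 2) * (2 / (2 * δ)) ^ 6) * (n : ℝ) ^ 6 :=
    sum_sq_mul_exp_le h2δ hn _
  have e1 : Real.exp (2 * δ / 2) = Real.exp δ := by congr 1; ring
  have e2 : (2 / (2 * δ)) = δ⁻¹ := by field_simp
  rw [e1, e2] at heng
  have hK : 0 ≤ (A / (n : ℝ) ^ 3) ^ 2 * (C_I * Real.exp (((R₀ : ℝ) + 1) * δ)) ^ 2 := by positivity
  calc _ ≤ ∑ b' ∈ S, ((A / (n : ℝ) ^ 3) ^ 2 * (C_I * Real.exp (((R₀ : ℝ) + 1) * δ)) ^ 2) * g (b' - b) := Finset.sum_le_sum hterm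
    _ = ((A / (n : ℝ) ^ 3) ^ 2 * (C_I * Real.exp (((R₀ : ℝ) + 1) * δ)) ^ 2) * ∑ z ∈ S.image (fun b' => b' - b), g z := by
        rw [← Finset.mul_sum, hsum]
    _ ≤ ((A / (n : ℝ) ^ 3) ^ 2 * (C_I * Real.exp (((R₀ : ℝ) + 1) * δ)) ^ 2) * ((1 + 9600 * Real.exp δ * δ⁻¹ ^ 6) * (n : ℝ) ^ 6) :=
        mul_le_mul_of_nonneg_left heng hK
    _ = A ^ 2 * (C_I * Real.exp (((R₀ : ℝ) + 1) * δ)) ^ 2 * (1 + 9600 * Real.exp δ * δ⁻¹ ^ 6) := by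
        field_simp

end Mix2Radius


/-- **(MIX-2) SUMMABLE SECOND MOMENT OVER `ℤ⁴` AT RADIUS `R₀·n`** (the `tsum` form RHOA-6e ∕ RHOA-8's `HasSum` bookkeeping consumes). [folklore] -/
theorem tsum_mix2_secondMoment_le_radius {U : Pt → Finset Pt} {W : Finset Pt} {qd : Pt → Pt → Pt → ℝ} {I : Pt → Pt → ℝ} {A C_I δ : ℝ} {n R₀ : ℕ}
    (hδ : 0 < δ) (hn : 1 ≤ n) (hU : ∀ b, ∀ u ∈ U b, supNorm (b - (n : ℤ) • u) ≤ R₀ * n)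
    (hW : ∀ w ∈ W, supNorm w ≤ n) (hq : ∀ b, ∑ u ∈ U b, ∑ w ∈ W, |qd u b (b + w)| ≤ A / (n : ℝ) ^ 3)
    (hI : ∀ c u, |I c u| ≤ C_I * Real.exp (-(δ / n) * (supNorm (c - (n : ℤ) • u) : ℝ))) (b : Pt) :
    (Summable fun b' : Pt => (supNorm (b' - b) : ℝ) ^ 2 *
        |∑ u ∈ U b, ∑ u' ∈ U b', (∑ w ∈ W, qd u b (b + w) * I (b + w) u') * (∑ w' ∈ W, qd u' b' (b' + w') * I (b' + w') u)|) ∧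
    ∑' b' : Pt, (supNorm (b' - b) : ℝ) ^ 2 *
        |∑ u ∈ U b, ∑ u' ∈ U b', (∑ w ∈ W, qd u b (b + w) * I (b + w) u') * (∑ w' ∈ W, qd u' b' (b' + w') * I (b' + w') u)|
      ≤ A ^ 2 * (C_I * Real.exp (((R₀ : ℝ) + 1) * δ)) ^ 2 * (1 + 9600 * Real.exp δ * δ⁻¹ ^ 6) := by
  have h := mix2_secondMoment_le_radius (U := U) (qd := qd) (I := I) hδ hn hU hW hq hI b
  have h0 : 0 ≤ fun b' : Pt => (supNorm (b' - b) : ℝ) ^ 2 *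
      |∑ u ∈ U b, ∑ u' ∈ U b', (∑ w ∈ W, qd u b (b + w) * I (b + w) u') * (∑ w' ∈ W, qd u' b' (b' + w') * I (b' + w') u)| :=
    fun b' => by positivity
  exact ⟨summable_of_sum_le h0 h, Real.tsum_le_of_sum_le h0 h⟩

end Summit.QuantumFields.BalabanUV.Beta.FP.MixLoopPowerCountingSeam

end
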